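import Summits.QuantumFields.BalabanUV.Beta.GAN24.OneStepLoopContractionTwoKernels
import Summits.QuantumFields.BalabanUV.Beta.GAN24.TwoVertexWordThreePointDecay

/-!
# `BalabanUV.Beta.GAN24.TwoVertexWordContraction` — binder row G-an2-4 ∕ (CONV-C), routes C-R6° («VALUES») × R7 («TWO CURRENCIES»), PART 205:
# THE SECOND TADPOLE OF CENSUS V196 — THE TRACE CONTRACTION `(i,j) ↦ tr(Y_k X_{[i,j],k})` OF THE GAUGE-FIXED LOOP COVARIANCE `Y = c⁻¹𝒢c⁻¹` AGAINST THE TWO-VERTEX WORD OF TWO LOCAL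
# BACKGROUNDS HAS THE β-CELL's WHOLE `LimitRate` END ON `ℤ^{d+1}` FOR EVERY LOCALISED LIPSCHITZ FAMILY WITH POINTWISE LIMITS, and for the tent family with NOTHING displayed.  The
# kernel `K_{t,k}(i,j) = Σ_{q,r} Y_{t,k}(q,r)X_{t,[i,j],k}(r,q)` is a FULL contraction over the unit torus (no free entry index): its (UD) and (SR) in `distK(i,j)` are PART 204's three-point
# decay summed against the bounded `Y` (`exists_traceContraction_bound`, volume-free letter `S` of PART 132's `sum_exp_distK_le`); its volume limit is PART 150's pair-window Tannery with the
# product majorant `e^{−κ|w₁|₁}·e^{−κ|w₂ − ẑ|₁}` (`tendsto_traceContraction`); the END is PART 140's `conv_of_decay_of_tendsto`.  With PARTs 200 ∕ 203 the three second-order shapes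
# of V196 — the loop `tr(YX_iYX_j)`, the tadpole `tr(YX_ic⁻¹X_j)` and this `tr(YX_{[i,j]})` — are now theorems about the same named class of leg data (unit b2b-balaban-gan24-p3, gen 62; v1)

NOT IN PRINT; OUR PROOF ([folklore] bookkeeping BY NAME over PART 204 (`exists_threePoint_twoVertexWord_rate`), PART 195 (`exists_loopCov_inputs`), PART 199 (`tendsto_word_pair_mul`), PART 150
(`tendsto_sum_window_pair`, `exp_neg_mul_l1_windowMap_sub_castT_le`), PART 153 (`exp_distK_le_exp_window_pair'`), PART 141 (`sum_idx_eq_sum_site`), PART 143 (`norm_le_of_entryDecay`),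
PART 132 (`sum_exp_distK_le`), PART 140 (`conv_of_decay_of_tendsto`), PART 201 ∕ 202 (the tent family), `B12Sec2to5.summable_exp_neg_l1`; [Balaban1987RG1] (1.20)–(1.22) p. 264 LOCATE the
one-loop shapes; nothing printed is a hypothesis).
HONEST FRAMING (cell contract, verbatim): «discharging `BetaPertH` makes Bałaban's UV stability UNCONDITIONAL — a real constructive-QFT result; it is NOT the
continuum limit and NOT the Clay problem.»  HONEST DEPENDENCY (verbatim): «continuum YM on T⁴ ⇐ BetaPertH ∧ nine spine estimates (0/9 proved); BetaPertH ⇐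
(D1) ∧ (D4) ∧ CAP+tail; G-an2-4 gates asym, D1 and NE2/3/4.»

WHAT THIS FILE PROVES (0 sorry, 0 `def`; `M_t = fine (Lb·1) (cubic (d+1) (2(t+1)))`, `Y_{t,k}` = PART 195's loop covariance,
`X_{t,[i,j],k} = avgTow (QBlev L M_t) (L^{d+1}) (k ↦ 𝒢_kP(V_{t,i})_k(𝒢_kP(V_{t,j})_k𝒢_k)) k`, `K_{t,k} = Matrix.of (i,j) ↦ tr(Y_{t,k}X_{t,[i,j],k})`, `e = unitIdx⁻¹`):
* §1 (torus `idx L M 0`, `d ≥ 2`) **`exists_traceContraction_bound`** — `∃ S ≥ 0` from `(d, κ)`: `‖Y(q,r)‖ ≤ B_Y`, `‖W_{ij}(r,q)‖ ≤ B_W e^{−κ(distK(r,i) + distK(i,j) + distK(q,j))}` ⟹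
  `‖tr(Y W_{ij})‖ ≤ B_Y B_W S e^{−κ distK(i,j)}` on EVERY torus; `trace_mul_sub_trace_mul` (the telescoping).
* §2 (cubic `side t → ∞`) **`tendsto_traceContraction`** — `Y_t` volume-uniformly bounded with EL₂, `W_t` with the window majorant `B_W e^{−κ|w₂ − ẑ|₁}e^{−κ|w₁|₁}` about two integer roots and EL₂
  ⟹ `tr(Y_tW_t)` converges (pair-window Tannery).
* §3 **`conv_traceContraction_insertionWords`** — THE END for `K_{t,k}` with the two-vertex words of every localised Lipschitz family with pointwise limits: `∃ κ₁ > 0, C, C′ ≥ 0, Π` with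
  `IsInfiniteVolumeLimit (Lb·1·2(t+1)) (Re K_{t,k}(e(·,μ′),e(0,ν′))) (Π k)`, `UniformDecay Π μ ν C (κ₁∕(d+1))`, `StepRate Π μ ν C′ (κ₁∕(d+1)) (√(L⁻¹))`, `KernelInputs`, second moments
  (`d + 1 ≥ 3`, `L ≥ 2`, every `Lb ≥ 1`, `a > 0`, `μ ≠ ν`); **`conv_traceContraction_tentWords`** — the tent family, NOTHING displayed.
WHAT IT DOES NOT DO: the signed sum of the three second-order shapes and its identification with Bałaban's `Π⁰` (row an1's dictionary); the indicator family; a value for any constant.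
SUPPLIER work; NEVER «G-an2-4 closed»; NOT (CONV-C), NOT D1, NOT `BetaPertH`, NOT continuum, NOT Clay.  Records: `HOME/b2b-balaban-gan24-p3/gen62/README.md`.
-/

noncomputable section

open scoped BigOperators ComplexConjugate Matrix Matrix.Norms.L2Operator Kronecker
open Filter Topology Finset Matrix

namespace Summit.QuantumFields.BalabanUV.Beta.GAN24.TwoVertexWordContraction

open Literature.MathematicalPhysics.QuantumFieldTheory.Balaban1983to89
open Literature.MathematicalPhysics.QuantumFieldTheory.Balaban1983to89.B5Prop11Plancherel (Tor fine)
open Literature.MathematicalPhysics.QuantumFieldTheory.Balaban1983to89.B5RealFields (reM)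
open Literature.MathematicalPhysics.QuantumFieldTheory.Balaban1983to89.B5G183RateUnitTower (lev)
open Literature.MathematicalPhysics.QuantumFieldTheory.Balaban1983to89.B12Sec2to5 (l1 betaPrime510 summable_exp_neg_l1)
open Literature.MathematicalPhysics.QuantumFieldTheory.Balaban1983to89.Beta (Site windowMap IsInfiniteVolumeLimit)
open Literature.MathematicalPhysics.QuantumFieldTheory.Balaban1983to89.Beta.FreeLegDictionary (cubic)
open Literature.MathematicalPhysics.QuantumFieldTheory.Balaban1983to89.Beta.BlockKernelVolumeSockets (evenPeriod tendsto_evenPeriod)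
open Literature.MathematicalPhysics.QuantumFieldTheory.Balaban1983to89.Beta.VectorTails (castT)
open Literature.MathematicalPhysics.QuantumFieldTheory.Balaban1983to89.Beta.LimitRate (StepRate limKernelOf KernelInputs)
open Literature.MathematicalPhysics.QuantumFieldTheory.Balaban1983to89.Beta.CompositionSingular (flucCov)
open Literature.MathematicalPhysics.QuantumFieldTheory.Balaban1983to89.Beta.BlockEffectiveAction (DelK)
open Summit.QuantumFields.BalabanUV.T4Continuum.BalabanLineAverage (QB)
open Summit.QuantumFields.BalabanUV.T4Continuum.BalabanAveragedTowerModes (par rem)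
open Summit.QuantumFields.BalabanUV.T4Continuum.CovariantAveragingTower (avgTow)
open Summit.QuantumFields.BalabanUV.T4Continuum.BalabanAveragedTowerUnit (idx QBlev calGlev unitCovB one_le_lev')
open Summit.QuantumFields.BalabanUV.T4Continuum.BalabanAveragedCoerciveTower (unitIdx)
open Summit.QuantumFields.BalabanUV.T4Continuum.CTKingTowerWeights (rho distK distK_comm)
open Summit.QuantumFields.BalabanUV.T4Continuum.FirstOrderBackgroundModel (LipschitzBackground Pmodel)
open Summit.QuantumFields.BalabanUV.T4Continuum.DecayRateInterpolation (EntryDecay TwoLevelDecayRate)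
open Summit.QuantumFields.BalabanUV.Beta.GAN24.DiagramDecayAlgebra (twoLevelDecayRate_const_nonneg)
open Summit.QuantumFields.BalabanUV.Beta.GAN24.UnitLatticeDecayAlgebra (distK_nonneg sum_exp_distK_le)
open Summit.QuantumFields.BalabanUV.Beta.GAN24.DiagramVolumeLimit (conv_of_decay_of_tendsto)
open Summit.QuantumFields.BalabanUV.Beta.GAN24.DiagramVolumeLimitAlgebra (sum_idx_eq_sum_site)
open Summit.QuantumFields.BalabanUV.Beta.GAN24.DiagramVolumeLimitSandwich (norm_le_of_entryDecay)
open Summit.QuantumFields.BalabanUV.Beta.GAN24.DiagramVolumeLimitLegs (tendsto_sum_window_pair exp_neg_mul_l1_windowMap_sub_castT_le)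
open Summit.QuantumFields.BalabanUV.Beta.GAN24.DiagramVolumeLimitOneLoop (exp_distK_le_exp_window_pair')
open Summit.QuantumFields.BalabanUV.Beta.GAN24.OneStepLoopCovarianceInputTriple (exists_loopCov_inputs)
open Summit.QuantumFields.BalabanUV.Beta.GAN24.InsertionWordVolumeLimitSides (tendsto_word_pair_mul)
open Summit.QuantumFields.BalabanUV.Beta.GAN24.KingWeightTwoLevel (lipschitzBackground_tent rho_nonpos_of_tent_ne_zero)
open Summit.QuantumFields.BalabanUV.Beta.GAN24.TentBackgroundLegs (tendsto_tent_reading)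
open Summit.QuantumFields.BalabanUV.Beta.GAN24.TwoVertexWordThreePointDecay (exists_threePoint_twoVertexWord_rate)

variable {d : ℕ} (L : ℕ) [NeZero L]

/-! ## §1 The trace contraction against a three-point-decaying word, every torus -/

/-- **`exists_traceContraction_bound` — A BOUNDED KERNEL CONTRACTED AGAINST A THREE-POINT-DECAYING WORD DECAYS IN THE DISTANCE OF THE ROOTS** [our proof] (`d ≥ 2`, `κ > 0`): `∃ S ≥ 0`
from `(d, κ)` such that on EVERY torus, for every `Y` with `‖Y(q,r)‖ ≤ B_Y` (`B_Y ≥ 0`) and every root-indexed family `W_{ij}` with `‖W_{ij}(r,q)‖ ≤ B_W·e^{−κ(distK(r,i) + distK(i,j) + distK(q,j))}`: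
`‖tr(Y·W_{ij})‖ ≤ B_Y·B_W·S·e^{−κ·distK(i,j)}` for all `i, j` (`S = (d·S₀)²`, `S₀` PART 132's letter). -/
theorem exists_traceContraction_bound (hd : 2 ≤ d) {κ : ℝ} (hκ : 0 < κ) :
    ∃ S : ℝ, 0 ≤ S ∧ ∀ (M : Fin d → ℕ) [∀ μ, NeZero (M μ)] (Y : Matrix (idx L M 0) (idx L M 0) ℂ) (W : idx L M 0 → idx L M 0 → Matrix (idx L M 0) (idx L M 0) ℂ) (BY BW : ℝ),
      0 ≤ BY → (∀ q r, ‖Y q r‖ ≤ BY) → (∀ i j r q, ‖W i j r q‖ ≤ BW * Real.exp (-(κ * (distK L M r i + distK L M i j + distK L M q j)))) →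
      ∀ i j, ‖(Y * W i j).trace‖ ≤ BY * BW * S * Real.exp (-(κ * distK L M i j)) := by
  obtain ⟨S₀, hS₀, hS⟩ := sum_exp_distK_le (d := d) hd hκ
  refine ⟨(d * S₀) * (d * S₀), by positivity, fun M _ Y W BY BW hBY hYb hWb i j => ?_⟩
  have hBW : 0 ≤ BW := by
    have h := hWb i j i i
    exact nonneg_of_mul_nonneg_left ((norm_nonneg _).trans h) (Real.exp_pos _)
  have e : (Y * W i j).trace = ∑ q, ∑ r, Y q r * W i j r q := by
    simp only [Matrix.trace, Matrix.diag_apply, Matrix.mul_apply]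
  rw [e]
  have hterm : ∀ q r, ‖Y q r * W i j r q‖ ≤ BY * BW * Real.exp (-(κ * distK L M i j)) * (Real.exp (-(κ * distK L M j q)) * Real.exp (-(κ * distK L M i r))) := by
    intro q r
    rw [norm_mul]
    refine (mul_le_mul (hYb q r) (hWb i j r q) (norm_nonneg _) hBY).trans (le_of_eq ?_)
    rw [distK_comm L M r i, distK_comm L M q j, show -(κ * (distK L M i r + distK L M i j + distK L M j q)) = -(κ * distK L M i j) + (-(κ * distK L M j q) + -(κ * distK L M i r)) by ring,
      Real.exp_add, Real.exp_add]
    ring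
  calc ‖∑ q, ∑ r, Y q r * W i j r q‖
      ≤ ∑ q, ∑ r, BY * BW * Real.exp (-(κ * distK L M i j)) * (Real.exp (-(κ * distK L M j q)) * Real.exp (-(κ * distK L M i r))) :=
        norm_sum_le_of_le _ fun q _ => norm_sum_le_of_le _ fun r _ => hterm q r
    _ = BY * BW * Real.exp (-(κ * distK L M i j)) * ((∑ q, Real.exp (-(κ * distK L M j q))) * ∑ r, Real.exp (-(κ * distK L M i r))) := by
        rw [Finset.sum_mul_sum]
        simp only [← Finset.mul_sum]
    _ ≤ BY * BW * Real.exp (-(κ * distK L M i j)) * ((d * S₀) * (d * S₀)) := by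
        refine mul_le_mul_of_nonneg_left (mul_le_mul (hS L M j) (hS L M i) (Finset.sum_nonneg fun _ _ => (Real.exp_pos _).le) (by positivity)) (by positivity)
    _ = BY * BW * ((d * S₀) * (d * S₀)) * Real.exp (-(κ * distK L M i j)) := by ring

/-- the telescoping of the contraction: `tr(Y′W′) − tr(YW) = tr((Y′ − Y)W′) + tr(Y(W′ − W))`. [folklore] -/
theorem trace_mul_sub_trace_mul {n : Type*} [Fintype n] (Y Y' W W' : Matrix n n ℂ) :
    (Y' * W').trace - (Y * W).trace = ((Y' - Y) * W').trace + (Y * (W' - W)).trace := by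
  rw [Matrix.sub_mul, Matrix.mul_sub, Matrix.trace_sub, Matrix.trace_sub]; ring

/-! ## §2 The volume limit of the trace contraction: pair-window Tannery -/

section Volume

variable {side : ℕ → ℕ} [∀ t, NeZero (side t)]

/-- **`tendsto_traceContraction` — THE TRACE CONTRACTION CONVERGES ALONG `side t → ∞`** [our proof]: `Y_t` volume-uniformly bounded (`‖Y_t(q,r)‖ ≤ B_Y`) with EL₂, and `W_t` with the window
majorant `‖W_t(e(w₂,l₂), e(w₁,l₁))‖ ≤ B_W·e^{−κ|windowMap(w₂ − ẑ_t)|₁}·e^{−κ|windowMap w₁|₁}` (`κ > 0`; decay about the roots `ẑ` and `0`) with EL₂ ⟹ `tr(Y_tW_t) = Σ_{q,r} Y_t(q,r)W_t(r,q)`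
converges — PART 150's `tendsto_sum_window_pair` with the product majorant `(d·B_YB_W·e^{−κ|y₁|₁})·(e^{3κ|z|₁}e^{−κ|y₂|₁})` (root shift). -/
theorem tendsto_traceContraction (hside : Tendsto side atTop atTop)
    {Y W : (t : ℕ) → Matrix (idx L (cubic d (side t)) 0) (idx L (cubic d (side t)) 0) ℂ} {BY BW κ : ℝ} (hBY : 0 ≤ BY) (hBW : 0 ≤ BW) (hκ : 0 < κ)
    (hYb : ∀ t q r, ‖Y t q r‖ ≤ BY) (z : Fin d → ℤ)
    (hWb : ∀ t (w₁ : Site d (side t)) (l₁ : Fin d) (w₂ : Site d (side t)) (l₂ : Fin d),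
      ‖W t ((unitIdx L (cubic d (side t))).symm (w₂, l₂)) ((unitIdx L (cubic d (side t))).symm (w₁, l₁))‖
        ≤ BW * (Real.exp (-κ * l1 (windowMap d (side t) (w₂ - castT (cubic d (side t)) z))) * Real.exp (-κ * l1 (windowMap d (side t) w₁))))
    (hYel : ∀ (l l' : Fin d) (u v : Fin d → ℤ), ∃ s' : ℂ, Tendsto (fun t => Y t ((unitIdx L (cubic d (side t))).symm (castT (cubic d (side t)) u, l))
      ((unitIdx L (cubic d (side t))).symm (castT (cubic d (side t)) v, l'))) atTop (𝓝 s'))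
    (hWel : ∀ (l l' : Fin d) (u v : Fin d → ℤ), ∃ s' : ℂ, Tendsto (fun t => W t ((unitIdx L (cubic d (side t))).symm (castT (cubic d (side t)) u, l))
      ((unitIdx L (cubic d (side t))).symm (castT (cubic d (side t)) v, l'))) atTop (𝓝 s')) :
    ∃ s' : ℂ, Tendsto (fun t => (Y t * W t).trace) atTop (𝓝 s') := by
  choose P hP using hYel
  choose R hR using hWel
  refine ⟨∑ l₁, ∑' y₁, ∑' y₂, ∑ l₂, P l₁ l₂ y₁ y₂ * R l₂ l₁ y₂ y₁, ?_⟩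
  have e : ∀ t, (Y t * W t).trace = ∑ l₁ : Fin d, ∑ w₁ : Site d (side t), ∑ w₂ : Site d (side t), ∑ l₂ : Fin d,
      Y t ((unitIdx L (cubic d (side t))).symm (w₁, l₁)) ((unitIdx L (cubic d (side t))).symm (w₂, l₂))
        * W t ((unitIdx L (cubic d (side t))).symm (w₂, l₂)) ((unitIdx L (cubic d (side t))).symm (w₁, l₁)) := by
    intro t
    simp only [Matrix.trace, Matrix.diag_apply, Matrix.mul_apply]
    rw [sum_idx_eq_sum_site]
    refine Finset.sum_congr rfl fun l₁ _ => Finset.sum_congr rfl fun w₁ _ => ?_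
    rw [sum_idx_eq_sum_site, Finset.sum_comm]
  simp only [e]
  refine tendsto_finsetSum _ fun l₁ _ => ?_
  refine tendsto_sum_window_pair hside
    (F := fun t w₁ w₂ => ∑ l₂ : Fin d,
      Y t ((unitIdx L (cubic d (side t))).symm (w₁, l₁)) ((unitIdx L (cubic d (side t))).symm (w₂, l₂))
        * W t ((unitIdx L (cubic d (side t))).symm (w₂, l₂)) ((unitIdx L (cubic d (side t))).symm (w₁, l₁)))
    (fun y₁ y₂ => tendsto_finsetSum _ fun l₂ _ => (hP l₁ l₂ y₁ y₂).mul (hR l₂ l₁ y₂ y₁))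
    (b₁ := fun y => d * (BY * BW) * Real.exp (-κ * l1 y)) (b₂ := fun y => Real.exp (3 * κ * l1 z) * Real.exp (-κ * l1 y))
    ((summable_exp_neg_l1 hκ d).mul_left _) ((summable_exp_neg_l1 hκ d).mul_left _) (fun y => by positivity) (fun y => by positivity) fun t w₁ w₂ => ?_
  calc ‖∑ l₂ : Fin d, Y t _ _ * W t _ _‖
      ≤ ∑ _l₂ : Fin d, BY * BW * (Real.exp (-κ * l1 (windowMap d (side t) w₁)) * (Real.exp (3 * κ * l1 z) * Real.exp (-κ * l1 (windowMap d (side t) w₂)))) := by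
        refine norm_sum_le_of_le _ fun l₂ _ => ?_
        rw [norm_mul]
        have h1 := hYb t ((unitIdx L (cubic d (side t))).symm (w₁, l₁)) ((unitIdx L (cubic d (side t))).symm (w₂, l₂))
        have h3 := hWb t w₁ l₁ w₂ l₂
        have h5 := exp_neg_mul_l1_windowMap_sub_castT_le (side t) hκ.le w₂ z
        calc ‖Y t _ _‖ * ‖W t _ _‖
            ≤ BY * (BW * (Real.exp (-κ * l1 (windowMap d (side t) (w₂ - castT (cubic d (side t)) z))) * Real.exp (-κ * l1 (windowMap d (side t) w₁)))) :=
              mul_le_mul h1 h3 (norm_nonneg _) hBY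
          _ ≤ BY * (BW * ((Real.exp (3 * κ * l1 z) * Real.exp (-κ * l1 (windowMap d (side t) w₂))) * Real.exp (-κ * l1 (windowMap d (side t) w₁)))) := by
              gcongr
          _ = _ := by ring
    _ = (d * (BY * BW) * Real.exp (-κ * l1 (windowMap d (side t) w₁))) * (Real.exp (3 * κ * l1 z) * Real.exp (-κ * l1 (windowMap d (side t) w₂))) := by
        rw [Finset.sum_const, Finset.card_univ, Fintype.card_fin, nsmul_eq_mul]; ring

end Volume

/-! ## §3 THE END: the second tadpole of census V196 with the two-vertex words of a localised Lipschitz family, and of the tent family -/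

section End

variable (Lb : ℕ) [NeZero Lb] (a : ℝ) (ha : 0 < a)

omit [NeZero L] in
/-- the reading of the zero vector is zero. [folklore] -/
theorem castT_zero {n : ℕ} (N : Fin n → ℕ) : castT N (0 : Fin n → ℤ) = 0 := by
  funext i; simp [castT]

/-- **`conv_traceContraction_insertionWords` — THE SECOND TADPOLE `(i,j) ↦ tr(Y_{t,k}X_{t,[i,j],k})` ON `ℤ^{d+1}` FOR EVERY LOCALISED LIPSCHITZ FAMILY WITH POINTWISE LIMITS** [our proof]
(`d + 1 ≥ 3`, `L ≥ 2`, every `Lb ≥ 1`, `a > 0`, `μ ≠ ν`, coarse volumes `2(t+1)`, `M_t = fine (Lb·1) (cubic (2(t+1)))`; backgrounds `V_{t,x}` with common `(α, β)`, supported where `ρ_{k,x} ≤ c₀`,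
converging at fine integer readings about every integer root): `∃ κ₁ > 0, C, C′ ≥ 0, Π` with `IsInfiniteVolumeLimit (Lb·1·2(t+1)) (Re tr(Y_{t,k}X_{t,[e(·,μ′),e(0,ν′)],k})) (Π k)`,
`UniformDecay Π μ ν C (κ₁∕(d+1))`, `StepRate Π μ ν C′ (κ₁∕(d+1)) (√(L⁻¹))`, `KernelInputs (d+1) Π`, second-moment convergence — (UD)+(SR) by §1 on PART 204's three-point envelopes and PART 195's
bounds for `Y`, EL by §2 with PART 199's EL₂ of the word `[i,j]`, the END by PART 140.  NO residual hypothesis on the words. [cite: Balaban1987RG1, (1.20)–(1.22) p.264 (shapes)] -/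
theorem conv_traceContraction_insertionWords (hL : 2 ≤ L) (hd : 2 ≤ d) {μ ν : Fin (d + 1)} (hne : μ ≠ ν) {α β c₀ : ℝ}
    {V : (t : ℕ) → idx L (fine (Lb * 1) (cubic (d + 1) (evenPeriod t))) 0 → (k : ℕ) → Fin (d + 1) → (idx L (fine (Lb * 1) (cubic (d + 1) (evenPeriod t))) k → ℂ)}
    (hV : ∀ t i, LipschitzBackground L (fine (Lb * 1) (cubic (d + 1) (evenPeriod t))) (V t i) α β)
    (hloc : ∀ t i k μ u, V t i k μ u ≠ 0 → rho L (fine (Lb * 1) (cubic (d + 1) (evenPeriod t))) k i u ≤ c₀)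
    (hel : ∀ (z : Fin (d + 1) → ℤ) (μ' : Fin (d + 1)) (k : ℕ) (μ f : Fin (d + 1)) (w : Fin (d + 1) → ℤ), ∃ s : ℂ,
      Tendsto (fun t => V t ((unitIdx L (fine (Lb * 1) (cubic (d + 1) (evenPeriod t)))).symm (castT (fine (Lb * 1) (cubic (d + 1) (evenPeriod t))) z, μ')) k μ (castT (fine (lev L k) (fine (Lb * 1) (cubic (d + 1) (evenPeriod t)))) w, f)) atTop (𝓝 s)) :
    ∃ κ₁ C C' : ℝ, 0 < κ₁ ∧ 0 ≤ C ∧ 0 ≤ C' ∧ ∃ Pinf : ℕ → B12Beta.Kernel (d + 1),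
      (∀ k, IsInfiniteVolumeLimit (fun t => Lb * 1 * evenPeriod t)
        (fun t μ' ν' (z : Beta.Site (d + 1) (Lb * 1 * evenPeriod t)) => (((((unitCovB L (fine (Lb * 1) (cubic (d + 1) (evenPeriod t))) a ha k)⁻¹ * (((flucCov (reM (DelK (lev L k) (one_le_lev' L k) (fine (Lb * 1) (cubic (d + 1) (evenPeriod t))) a ha)) (Matrix.fromRows (reM (QB 1 Lb (cubic (d + 1) (evenPeriod t)))) (fun (t' : {x : Tor (fine (Lb * 1) (cubic (d + 1) (evenPeriod t))) × Fin (d + 1) // (∀ ν, ν < x.2 → ((rem 1 Lb (cubic (d + 1) (evenPeriod t)) x.1 ν : ℕ)) = 0) ∧ ((rem 1 Lb (cubic (d + 1) (evenPeriod t)) x.1 x.2 : ℕ)) + 1 < Lb}) (x : Tor (fine (Lb * 1) (cubic (d + 1) (evenPeriod t))) × Fin (d + 1)) => if x = (Function.Embedding.subtype (fun x : Tor (fine (Lb * 1) (cubic (d + 1) (evenPeriod t))) × Fin (d + 1) => (∀ ν, ν < x.2 → ((rem 1 Lb (cubic (d + 1) (evenPeriod t)) x.1 ν : ℕ)) = 0)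 ∧ ((rem 1 Lb (cubic (d + 1) (evenPeriod t)) x.1 x.2 : ℕ)) + 1 < Lb)) t' then (1 : ℝ) else 0))).map ((↑) : ℝ → ℂ)).submatrix (unitIdx L (fine (Lb * 1) (cubic (d + 1) (evenPeriod t)))) (unitIdx L (fine (Lb * 1) (cubic (d + 1) (evenPeriod t))))) * (unitCovB L (fine (Lb * 1) (cubic (d + 1) (evenPeriod t))) a ha k)⁻¹)) * (avgTow (QBlev L (fine (Lb * 1) (cubic (d + 1) (evenPeriod t)))) ((L : ℝ) ^ (d + 1)) (fun k => calGlev L (fine (Lb * 1) (cubic (d + 1) (evenPeriod t))) a ha k * Pmodel L (fine (Lb * 1) (cubic (d + 1) (evenPeriod t))) (V t ((unitIdx L (fine (Lb * 1) (cubic (d + 1) (evenPeriod t)))).symm (z, μ'))) k * (calGlev L (fine (Lb * 1) (cubic (d + 1) (evenPeriod t))) a ha k * Pmodel L (fine (Lb * 1) (cubic (d + 1) (evenPeriod t))) (V t ((unitIdx L (fine (Lb * 1) (cubic (d + 1) (evenPeriod t)))).symm (0, ν'))) k * calGlev L (fine (Lb * 1) (cubic (d + 1) (evenPeriod t))) a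 ha k)) k)).trace).re) (Pinf k)) ∧
      Beta.LimitRate.UniformDecay Pinf μ ν C (κ₁ / (((d + 1 : ℕ)) : ℝ)) ∧
      StepRate Pinf μ ν C' (κ₁ / (((d + 1 : ℕ)) : ℝ)) (Real.sqrt ((L : ℝ)⁻¹)) ∧
      (∃ K : KernelInputs (d + 1) Pinf, K.θ = Real.sqrt ((L : ℝ)⁻¹) ∧ K.c₀ = betaPrime510 (d + 1) (C' / (1 - Real.sqrt ((L : ℝ)⁻¹))) (κ₁ / (((d + 1 : ℕ)) : ℝ)) ∧
        K.Pinf = limKernelOf Pinf ∧ K.μ = μ ∧ K.ν = ν) ∧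
      (∀ k, |B12Beta.secondMoment (Pinf k) μ ν - B12Beta.secondMoment (limKernelOf Pinf) μ ν|
          ≤ betaPrime510 (d + 1) (C' / (1 - Real.sqrt ((L : ℝ)⁻¹))) (κ₁ / (((d + 1 : ℕ)) : ℝ)) * Real.sqrt ((L : ℝ)⁻¹) ^ k) := by
  have hd1 : 1 ≤ d := le_trans (by norm_num) hd
  have hD3 : 2 ≤ d + 1 := by omega
  have hL1 : (1 : ℝ) < L := by exact_mod_cast (lt_of_lt_of_le one_lt_two hL : 1 < L)
  have hθ0 : 0 ≤ Real.sqrt ((L : ℝ)⁻¹) := Real.sqrt_nonneg _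
  have hθ1 : Real.sqrt ((L : ℝ)⁻¹) < 1 := by
    rw [show (1 : ℝ) = Real.sqrt 1 from Real.sqrt_one.symm]
    exact Real.sqrt_lt_sqrt (inv_nonneg.mpr (Nat.cast_nonneg _)) (inv_lt_one_of_one_lt₀ hL1)
  have hside : Tendsto (fun t => Lb * 1 * evenPeriod t) atTop atTop :=
    Filter.Tendsto.const_mul_atTop' (Nat.pos_of_ne_zero (NeZero.ne (Lb * 1))) tendsto_evenPeriod
  -- the loop covariance's triple (PART 195, auxiliary mass `1`)
  obtain ⟨κ₀, BY, BY', hκ₀, hBY, hudY, hsrY, helY⟩ := exists_loopCov_inputs L a ha Lb evenPeriod hL hd1 tendsto_evenPeriod one_pos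
  have hBY' : 0 ≤ BY' := by
    haveI : Nonempty (idx L (fine (Lb * 1) (cubic (d + 1) (evenPeriod 0))) 0) := ⟨(unitIdx L _).symm (0, μ)⟩
    exact twoLevelDecayRate_const_nonneg (hsrY 0)
  -- the two-vertex words' three-point envelopes (PART 204) and the contraction letter (§1)
  obtain ⟨κW, BW, BW', hκW, hBW, hBW', hW⟩ := exists_threePoint_twoVertexWord_rate L a ha (d := d + 1) hL (by omega) α β c₀
  obtain ⟨S, hS0, hS⟩ := exists_traceContraction_bound L (d := d + 1) hD3 hκW
  -- sup bounds for `Y` and its steps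
  have hYb : ∀ t k (q r : idx L (fine (Lb * 1) (cubic (d + 1) (evenPeriod t))) 0), ‖(((unitCovB L (fine (Lb * 1) (cubic (d + 1) (evenPeriod t))) a ha k)⁻¹ * (((flucCov (reM (DelK (lev L k) (one_le_lev' L k) (fine (Lb * 1) (cubic (d + 1) (evenPeriod t))) a ha)) (Matrix.fromRows (reM (QB 1 Lb (cubic (d + 1) (evenPeriod t)))) (fun (t' : {x : Tor (fine (Lb * 1) (cubic (d + 1) (evenPeriod t))) × Fin (d + 1) // (∀ ν, ν < x.2 → ((rem 1 Lb (cubic (d + 1) (evenPeriod t)) x.1 ν : ℕ)) = 0) ∧ ((rem 1 Lb (cubic (d + 1) (evenPeriod t)) x.1 x.2 : ℕ)) + 1 < Lb}) (x : Tor (fine (Lb * 1) (cubic (d + 1) (evenPeriod t))) × Fin (d + 1)) => if x = (Function.Embedding.subtype (fun x : Tor (fine (Lb * 1) (cubic (d + 1) (evenPeriod t))) × Fin (d + 1) => (∀ ν, ν < x.2 → ((rem 1 Lb (cubic (d + 1) (evenPeriod t)) x.1 ν : ℕ)) = 0) ∧ ((rem 1 Lb (cubic (d + 1) (evenPeriod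 t)) x.1 x.2 : ℕ)) + 1 < Lb)) t' then (1 : ℝ) else 0))).map ((↑) : ℝ → ℂ)).submatrix (unitIdx L (fine (Lb * 1) (cubic (d + 1) (evenPeriod t)))) (unitIdx L (fine (Lb * 1) (cubic (d + 1) (evenPeriod t))))) * (unitCovB L (fine (Lb * 1) (cubic (d + 1) (evenPeriod t))) a ha k)⁻¹)) q r‖ ≤ BY :=
    fun t k q r => norm_le_of_entryDecay L (Lb * 1 * evenPeriod t) hκ₀.le hBY (hudY t k) q r
  have hYb' : ∀ t k (q r : idx L (fine (Lb * 1) (cubic (d + 1) (evenPeriod t))) 0), ‖((((unitCovB L (fine (Lb * 1) (cubic (d + 1) (evenPeriod t))) a ha (k + 1))⁻¹ * (((flucCov (reM (DelK (lev L (k + 1)) (one_le_lev' L (k + 1)) (fine (Lb * 1) (cubic (d + 1) (evenPeriod t))) a ha)) (Matrix.fromRows (reM (QB 1 Lb (cubic (d + 1) (evenPeriod t)))) (fun (t' : {x : Tor (fine (Lb * 1) (cubic (d + 1) (evenPeriod t))) × Fin (d + 1) // (∀ ν, ν < x.2 → ((rem 1 Lb (cubic (d + 1) (evenPeriod t)) x.1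 ν : ℕ)) = 0) ∧ ((rem 1 Lb (cubic (d + 1) (evenPeriod t)) x.1 x.2 : ℕ)) + 1 < Lb}) (x : Tor (fine (Lb * 1) (cubic (d + 1) (evenPeriod t))) × Fin (d + 1)) => if x = (Function.Embedding.subtype (fun x : Tor (fine (Lb * 1) (cubic (d + 1) (evenPeriod t))) × Fin (d + 1) => (∀ ν, ν < x.2 → ((rem 1 Lb (cubic (d + 1) (evenPeriod t)) x.1 ν : ℕ)) = 0) ∧ ((rem 1 Lb (cubic (d + 1) (evenPeriod t)) x.1 x.2 : ℕ)) + 1 < Lb)) t' then (1 : ℝ) else 0))).map ((↑) : ℝ → ℂ)).submatrix (unitIdx L (fine (Lb * 1) (cubic (d + 1) (evenPeriod t)))) (unitIdx L (fine (Lb * 1) (cubic (d + 1) (evenPeriod t))))) * (unitCovB L (fine (Lb * 1) (cubic (d + 1) (evenPeriod t))) a ha (k + 1))⁻¹)) - (((unitCovB L (fine (Lb * 1) (cubic (d + 1) (evenPeriod t))) a ha k)⁻¹ * (((flucCov (reM (DelK (lev L k) (one_le_lev' L k) (fine (Lb * 1) (cubic (d + 1) (evenPeriod t))) a ha)) (Matrix.fromRows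 (reM (QB 1 Lb (cubic (d + 1) (evenPeriod t)))) (fun (t' : {x : Tor (fine (Lb * 1) (cubic (d + 1) (evenPeriod t))) × Fin (d + 1) // (∀ ν, ν < x.2 → ((rem 1 Lb (cubic (d + 1) (evenPeriod t)) x.1 ν : ℕ)) = 0) ∧ ((rem 1 Lb (cubic (d + 1) (evenPeriod t)) x.1 x.2 : ℕ)) + 1 < Lb}) (x : Tor (fine (Lb * 1) (cubic (d + 1) (evenPeriod t))) × Fin (d + 1)) => if x = (Function.Embedding.subtype (fun x : Tor (fine (Lb * 1) (cubic (d + 1) (evenPeriod t))) × Fin (d + 1) => (∀ ν, ν < x.2 → ((rem 1 Lb (cubic (d + 1) (evenPeriod t)) x.1 ν : ℕ)) = 0) ∧ ((rem 1 Lb (cubic (d + 1) (evenPeriod t)) x.1 x.2 : ℕ)) + 1 < Lb)) t' then (1 : ℝ) else 0))).map ((↑) : ℝ → ℂ)).submatrix (unitIdx L (fine (Lb * 1) (cubic (d + 1) (evenPeriod t)))) (unitIdx L (fine (Lb * 1) (cubic (d + 1) (evenPeriod t))))) * (unitCovB L (fine (Lb * 1) (cubic (d + 1) (evenPeriod t)))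 a ha k)⁻¹))) q r‖ ≤ BY' * Real.sqrt ((L : ℝ)⁻¹) ^ k := by
    intro t k q r
    have h1 := hsrY t k q r
    have h2 : Real.exp (-(κ₀ * distK L (fine (Lb * 1) (cubic (d + 1) (evenPeriod t))) q r)) ≤ 1 := by
      rw [← Real.exp_zero]
      have := distK_nonneg L (fine (Lb * 1) (cubic (d + 1) (evenPeriod t))) q r
      exact Real.exp_le_exp.mpr (by nlinarith)
    calc _ ≤ BY' * Real.sqrt ((L : ℝ)⁻¹) ^ k * Real.exp (-(κ₀ * distK L (fine (Lb * 1) (cubic (d + 1) (evenPeriod t))) q r)) := h1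
      _ ≤ BY' * Real.sqrt ((L : ℝ)⁻¹) ^ k * 1 := mul_le_mul_of_nonneg_left h2 (mul_nonneg hBY' (pow_nonneg hθ0 k))
      _ = _ := mul_one _
  -- (UD)
  have hud : ∀ t k, EntryDecay (distK L (fine (Lb * 1) (cubic (d + 1) (evenPeriod t)))) (Matrix.of fun (i j : idx L (fine (Lb * 1) (cubic (d + 1) (evenPeriod t))) 0) => ((((unitCovB L (fine (Lb * 1) (cubic (d + 1) (evenPeriod t))) a ha k)⁻¹ * (((flucCov (reM (DelK (lev L k) (one_le_lev' L k) (fine (Lb * 1) (cubic (d + 1) (evenPeriod t))) a ha)) (Matrix.fromRows (reM (QB 1 Lb (cubic (d + 1) (evenPeriod t)))) (fun (t' : {x : Tor (fine (Lb * 1) (cubic (d + 1) (evenPeriod t))) × Fin (d + 1) // (∀ ν, ν < x.2 → ((rem 1 Lb (cubic (d + 1) (evenPeriod t)) x.1 ν : ℕ)) = 0) ∧ ((rem 1 Lb (cubic (d + 1) (evenPeriod t)) x.1 x.2 : ℕ)) + 1 < Lb}) (x : Tor (fine (Lb * 1) (cubic (d + 1) (evenPeriod t))) × Fin (d + 1))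 => if x = (Function.Embedding.subtype (fun x : Tor (fine (Lb * 1) (cubic (d + 1) (evenPeriod t))) × Fin (d + 1) => (∀ ν, ν < x.2 → ((rem 1 Lb (cubic (d + 1) (evenPeriod t)) x.1 ν : ℕ)) = 0) ∧ ((rem 1 Lb (cubic (d + 1) (evenPeriod t)) x.1 x.2 : ℕ)) + 1 < Lb)) t' then (1 : ℝ) else 0))).map ((↑) : ℝ → ℂ)).submatrix (unitIdx L (fine (Lb * 1) (cubic (d + 1) (evenPeriod t)))) (unitIdx L (fine (Lb * 1) (cubic (d + 1) (evenPeriod t))))) * (unitCovB L (fine (Lb * 1) (cubic (d + 1) (evenPeriod t))) a ha k)⁻¹)) * (avgTow (QBlev L (fine (Lb * 1) (cubic (d + 1) (evenPeriod t)))) ((L : ℝ) ^ (d + 1)) (fun k => calGlev L (fine (Lb * 1) (cubic (d + 1) (evenPeriod t))) a ha k * Pmodel L (fine (Lb * 1) (cubic (d + 1) (evenPeriod t))) (V t i) k * (calGlev L (fine (Lb * 1) (cubic (d + 1) (evenPeriod t))) a ha k * Pmodel L (fine (Lb * 1) (cubic (d + 1) (evenPeriod t))) (V t j) k * calGlev L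 (fine (Lb * 1) (cubic (d + 1) (evenPeriod t))) a ha k)) k)).trace) (BY * BW * S) κW := by
    intro t k i j
    rw [Matrix.of_apply]
    exact hS (fine (Lb * 1) (cubic (d + 1) (evenPeriod t))) (((unitCovB L (fine (Lb * 1) (cubic (d + 1) (evenPeriod t))) a ha k)⁻¹ * (((flucCov (reM (DelK (lev L k) (one_le_lev' L k) (fine (Lb * 1) (cubic (d + 1) (evenPeriod t))) a ha)) (Matrix.fromRows (reM (QB 1 Lb (cubic (d + 1) (evenPeriod t)))) (fun (t' : {x : Tor (fine (Lb * 1) (cubic (d + 1) (evenPeriod t))) × Fin (d + 1) // (∀ ν, ν < x.2 → ((rem 1 Lb (cubic (d + 1) (evenPeriod t)) x.1 ν : ℕ)) = 0) ∧ ((rem 1 Lb (cubic (d + 1) (evenPeriod t)) x.1 x.2 : ℕ)) + 1 < Lb}) (x : Tor (fine (Lb * 1) (cubic (d + 1) (evenPeriod t))) × Fin (d + 1)) => if x = (Function.Embedding.subtype (fun x : Tor (fine (Lb * 1) (cubic (d + 1) (evenPeriod t))) × Fin (d + 1) => (∀ ν, ν < x.2 → ((rem 1 Lb (cubic (d + 1)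 (evenPeriod t)) x.1 ν : ℕ)) = 0) ∧ ((rem 1 Lb (cubic (d + 1) (evenPeriod t)) x.1 x.2 : ℕ)) + 1 < Lb)) t' then (1 : ℝ) else 0))).map ((↑) : ℝ → ℂ)).submatrix (unitIdx L (fine (Lb * 1) (cubic (d + 1) (evenPeriod t)))) (unitIdx L (fine (Lb * 1) (cubic (d + 1) (evenPeriod t))))) * (unitCovB L (fine (Lb * 1) (cubic (d + 1) (evenPeriod t))) a ha k)⁻¹)) (fun i j => avgTow (QBlev L (fine (Lb * 1) (cubic (d + 1) (evenPeriod t)))) ((L : ℝ) ^ (d + 1)) (fun k => calGlev L (fine (Lb * 1) (cubic (d + 1) (evenPeriod t))) a ha k * Pmodel L (fine (Lb * 1) (cubic (d + 1) (evenPeriod t))) (V t i) k * (calGlev L (fine (Lb * 1) (cubic (d + 1) (evenPeriod t))) a ha k * Pmodel L (fine (Lb * 1) (cubic (d + 1) (evenPeriod t))) (V t j) k * calGlev L (fine (Lb * 1) (cubic (d + 1) (evenPeriod t))) a ha k)) k) BY BW hBY (hYb t k)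
      (fun i j r q => (hW (fine (Lb * 1) (cubic (d + 1) (evenPeriod t))) i j (V t i) (V t j) (hV t i) (hV t j) (hloc t i) (hloc t j)).1 k r q) i j
  -- (SR)
  have hsr : ∀ t, TwoLevelDecayRate (distK L (fine (Lb * 1) (cubic (d + 1) (evenPeriod t)))) (fun k => Matrix.of fun (i j : idx L (fine (Lb * 1) (cubic (d + 1) (evenPeriod t))) 0) => ((((unitCovB L (fine (Lb * 1) (cubic (d + 1) (evenPeriod t))) a ha k)⁻¹ * (((flucCov (reM (DelK (lev L k) (one_le_lev' L k) (fine (Lb * 1) (cubic (d + 1) (evenPeriod t))) a ha)) (Matrix.fromRows (reM (QB 1 Lb (cubic (d + 1) (evenPeriod t)))) (fun (t' : {x : Tor (fine (Lb * 1) (cubic (d + 1) (evenPeriod t))) × Fin (d + 1) // (∀ ν, ν < x.2 → ((rem 1 Lb (cubic (d + 1) (evenPeriod t)) x.1 ν : ℕ)) = 0) ∧ ((rem 1 Lb (cubic (d + 1) (evenPeriod t)) x.1 x.2 : ℕ)) + 1 < Lb}) (x : Tor (fine (Lb * 1) (cubic (d + 1) (evenPeriod t))) × Fin (d + 1)) =>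 if x = (Function.Embedding.subtype (fun x : Tor (fine (Lb * 1) (cubic (d + 1) (evenPeriod t))) × Fin (d + 1) => (∀ ν, ν < x.2 → ((rem 1 Lb (cubic (d + 1) (evenPeriod t)) x.1 ν : ℕ)) = 0) ∧ ((rem 1 Lb (cubic (d + 1) (evenPeriod t)) x.1 x.2 : ℕ)) + 1 < Lb)) t' then (1 : ℝ) else 0))).map ((↑) : ℝ → ℂ)).submatrix (unitIdx L (fine (Lb * 1) (cubic (d + 1) (evenPeriod t)))) (unitIdx L (fine (Lb * 1) (cubic (d + 1) (evenPeriod t))))) * (unitCovB L (fine (Lb * 1) (cubic (d + 1) (evenPeriod t))) a ha k)⁻¹)) * (avgTow (QBlev L (fine (Lb * 1) (cubic (d + 1) (evenPeriod t)))) ((L : ℝ) ^ (d + 1)) (fun k => calGlev L (fine (Lb * 1) (cubic (d + 1) (evenPeriod t))) a ha k * Pmodel L (fine (Lb * 1) (cubic (d + 1) (evenPeriod t))) (V t i) k * (calGlev L (fine (Lb * 1) (cubic (d + 1) (evenPeriod t))) a ha k * Pmodel L (fine (Lb * 1) (cubic (d + 1) (evenPeriod t))) (V t j) k * calGlev L (fine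 (Lb * 1) (cubic (d + 1) (evenPeriod t))) a ha k)) k)).trace)
      ((BY' * BW + BY * BW') * S) κW (Real.sqrt ((L : ℝ)⁻¹)) := by
    intro t k i j
    simp only [Matrix.sub_apply, Matrix.of_apply]
    rw [trace_mul_sub_trace_mul]
    refine (norm_add_le _ _).trans ?_
    have h1 := hS (fine (Lb * 1) (cubic (d + 1) (evenPeriod t))) ((((unitCovB L (fine (Lb * 1) (cubic (d + 1) (evenPeriod t))) a ha (k + 1))⁻¹ * (((flucCov (reM (DelK (lev L (k + 1)) (one_le_lev' L (k + 1)) (fine (Lb * 1) (cubic (d + 1) (evenPeriod t))) a ha)) (Matrix.fromRows (reM (QB 1 Lb (cubic (d + 1) (evenPeriod t)))) (fun (t' : {x : Tor (fine (Lb * 1) (cubic (d + 1) (evenPeriod t))) × Fin (d + 1) // (∀ ν, ν < x.2 → ((rem 1 Lb (cubic (d + 1) (evenPeriod t)) x.1 ν : ℕ)) = 0) ∧ ((rem 1 Lb (cubic (d + 1) (evenPeriod t)) x.1 x.2 : ℕ)) + 1 < Lb}) (x : Tor (fine (Lb * 1) (cubic (d + 1) (evenPeriod t))) × Fin (d + 1))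 => if x = (Function.Embedding.subtype (fun x : Tor (fine (Lb * 1) (cubic (d + 1) (evenPeriod t))) × Fin (d + 1) => (∀ ν, ν < x.2 → ((rem 1 Lb (cubic (d + 1) (evenPeriod t)) x.1 ν : ℕ)) = 0) ∧ ((rem 1 Lb (cubic (d + 1) (evenPeriod t)) x.1 x.2 : ℕ)) + 1 < Lb)) t' then (1 : ℝ) else 0))).map ((↑) : ℝ → ℂ)).submatrix (unitIdx L (fine (Lb * 1) (cubic (d + 1) (evenPeriod t)))) (unitIdx L (fine (Lb * 1) (cubic (d + 1) (evenPeriod t))))) * (unitCovB L (fine (Lb * 1) (cubic (d + 1) (evenPeriod t))) a ha (k + 1))⁻¹)) - (((unitCovB L (fine (Lb * 1) (cubic (d + 1) (evenPeriod t))) a ha k)⁻¹ * (((flucCov (reM (DelK (lev L k) (one_le_lev' L k) (fine (Lb * 1) (cubic (d + 1) (evenPeriod t))) a ha)) (Matrix.fromRows (reM (QB 1 Lb (cubic (d + 1) (evenPeriod t)))) (fun (t' : {x : Tor (fine (Lb * 1) (cubic (d + 1) (evenPeriod t))) × Fin (d + 1) // (∀ ν, ν < x.2 → ((rem 1 Lb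 (cubic (d + 1) (evenPeriod t)) x.1 ν : ℕ)) = 0) ∧ ((rem 1 Lb (cubic (d + 1) (evenPeriod t)) x.1 x.2 : ℕ)) + 1 < Lb}) (x : Tor (fine (Lb * 1) (cubic (d + 1) (evenPeriod t))) × Fin (d + 1)) => if x = (Function.Embedding.subtype (fun x : Tor (fine (Lb * 1) (cubic (d + 1) (evenPeriod t))) × Fin (d + 1) => (∀ ν, ν < x.2 → ((rem 1 Lb (cubic (d + 1) (evenPeriod t)) x.1 ν : ℕ)) = 0) ∧ ((rem 1 Lb (cubic (d + 1) (evenPeriod t)) x.1 x.2 : ℕ)) + 1 < Lb)) t' then (1 : ℝ) else 0))).map ((↑) : ℝ → ℂ)).submatrix (unitIdx L (fine (Lb * 1) (cubic (d + 1) (evenPeriod t)))) (unitIdx L (fine (Lb * 1) (cubic (d + 1) (evenPeriod t))))) * (unitCovB L (fine (Lb * 1) (cubic (d + 1) (evenPeriod t))) a ha k)⁻¹))) (fun i j => avgTow (QBlev L (fine (Lb * 1) (cubic (d + 1) (evenPeriod t)))) ((L : ℝ) ^ (d + 1)) (fun k => calGlev L (fine (Lb * 1) (cubic (d + 1) (evenPeriod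 t))) a ha k * Pmodel L (fine (Lb * 1) (cubic (d + 1) (evenPeriod t))) (V t i) k * (calGlev L (fine (Lb * 1) (cubic (d + 1) (evenPeriod t))) a ha k * Pmodel L (fine (Lb * 1) (cubic (d + 1) (evenPeriod t))) (V t j) k * calGlev L (fine (Lb * 1) (cubic (d + 1) (evenPeriod t))) a ha k)) (k + 1)) (BY' * Real.sqrt ((L : ℝ)⁻¹) ^ k) BW
      (mul_nonneg hBY' (pow_nonneg hθ0 k)) (hYb' t k) (fun i j r q => (hW (fine (Lb * 1) (cubic (d + 1) (evenPeriod t))) i j (V t i) (V t j) (hV t i) (hV t j) (hloc t i) (hloc t j)).1 (k + 1) r q) i j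
    have h2 := hS (fine (Lb * 1) (cubic (d + 1) (evenPeriod t))) (((unitCovB L (fine (Lb * 1) (cubic (d + 1) (evenPeriod t))) a ha k)⁻¹ * (((flucCov (reM (DelK (lev L k) (one_le_lev' L k) (fine (Lb * 1) (cubic (d + 1) (evenPeriod t))) a ha)) (Matrix.fromRows (reM (QB 1 Lb (cubic (d + 1) (evenPeriod t)))) (fun (t' : {x : Tor (fine (Lb * 1) (cubic (d + 1) (evenPeriod t))) × Fin (d + 1) // (∀ ν, ν < x.2 → ((rem 1 Lb (cubic (d + 1) (evenPeriod t)) x.1 ν : ℕ)) = 0) ∧ ((rem 1 Lb (cubic (d + 1) (evenPeriod t)) x.1 x.2 : ℕ)) + 1 < Lb}) (x : Tor (fine (Lb * 1) (cubic (d + 1) (evenPeriod t))) × Fin (d + 1)) => if x = (Function.Embedding.subtype (fun x : Tor (fine (Lb * 1) (cubic (d + 1) (evenPeriod t))) × Fin (d + 1) => (∀ ν, ν < x.2 → ((rem 1 Lb (cubic (d + 1) (evenPeriod t)) x.1 ν : ℕ)) = 0) ∧ ((rem 1 Lb (cubic (d + 1) (evenPeriod t)) x.1 x.2 : ℕ))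 + 1 < Lb)) t' then (1 : ℝ) else 0))).map ((↑) : ℝ → ℂ)).submatrix (unitIdx L (fine (Lb * 1) (cubic (d + 1) (evenPeriod t)))) (unitIdx L (fine (Lb * 1) (cubic (d + 1) (evenPeriod t))))) * (unitCovB L (fine (Lb * 1) (cubic (d + 1) (evenPeriod t))) a ha k)⁻¹)) (fun i j => (avgTow (QBlev L (fine (Lb * 1) (cubic (d + 1) (evenPeriod t)))) ((L : ℝ) ^ (d + 1)) (fun k => calGlev L (fine (Lb * 1) (cubic (d + 1) (evenPeriod t))) a ha k * Pmodel L (fine (Lb * 1) (cubic (d + 1) (evenPeriod t))) (V t i) k * (calGlev L (fine (Lb * 1) (cubic (d + 1) (evenPeriod t))) a ha k * Pmodel L (fine (Lb * 1) (cubic (d + 1) (evenPeriod t))) (V t j) k * calGlev L (fine (Lb * 1) (cubic (d + 1) (evenPeriod t))) a ha k)) (k + 1)) - (avgTow (QBlev L (fine (Lb * 1) (cubic (d + 1) (evenPeriod t)))) ((L : ℝ) ^ (d + 1)) (fun k => calGlev L (fine (Lb * 1) (cubic (d + 1) (evenPeriod t))) a ha k * Pmodel L (fine (Lb * 1) (cubic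 (d + 1) (evenPeriod t))) (V t i) k * (calGlev L (fine (Lb * 1) (cubic (d + 1) (evenPeriod t))) a ha k * Pmodel L (fine (Lb * 1) (cubic (d + 1) (evenPeriod t))) (V t j) k * calGlev L (fine (Lb * 1) (cubic (d + 1) (evenPeriod t))) a ha k)) k)) BY (BW' * Real.sqrt ((L : ℝ)⁻¹) ^ k) hBY (hYb t k)
      (fun i j r q => (hW (fine (Lb * 1) (cubic (d + 1) (evenPeriod t))) i j (V t i) (V t j) (hV t i) (hV t j) (hloc t i) (hloc t j)).2 k r q) i j
    refine (add_le_add h1 h2).trans (le_of_eq ?_)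
    ring
  -- EL at integer roots
  have hlim : ∀ k (μ' ν' : Fin (d + 1)) (z : Fin (d + 1) → ℤ), ∃ s' : ℂ,
      Tendsto (fun t => (Matrix.of fun (i j : idx L (fine (Lb * 1) (cubic (d + 1) (evenPeriod t))) 0) => ((((unitCovB L (fine (Lb * 1) (cubic (d + 1) (evenPeriod t))) a ha k)⁻¹ * (((flucCov (reM (DelK (lev L k) (one_le_lev' L k) (fine (Lb * 1) (cubic (d + 1) (evenPeriod t))) a ha)) (Matrix.fromRows (reM (QB 1 Lb (cubic (d + 1) (evenPeriod t)))) (fun (t' : {x : Tor (fine (Lb * 1) (cubic (d + 1) (evenPeriod t))) × Fin (d + 1) // (∀ ν, ν < x.2 → ((rem 1 Lb (cubic (d + 1) (evenPeriod t)) x.1 ν : ℕ)) = 0) ∧ ((rem 1 Lb (cubic (d + 1) (evenPeriod t)) x.1 x.2 : ℕ)) + 1 < Lb}) (x : Tor (fine (Lb * 1) (cubic (d + 1) (evenPeriod t))) × Fin (d + 1)) => if x = (Function.Embedding.subtype (fun x : Tor (fine (Lb * 1) (cubic (d + 1) (evenPeriod t))) × Fin (d + 1) => (∀ ν, ν < x.2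 → ((rem 1 Lb (cubic (d + 1) (evenPeriod t)) x.1 ν : ℕ)) = 0) ∧ ((rem 1 Lb (cubic (d + 1) (evenPeriod t)) x.1 x.2 : ℕ)) + 1 < Lb)) t' then (1 : ℝ) else 0))).map ((↑) : ℝ → ℂ)).submatrix (unitIdx L (fine (Lb * 1) (cubic (d + 1) (evenPeriod t)))) (unitIdx L (fine (Lb * 1) (cubic (d + 1) (evenPeriod t))))) * (unitCovB L (fine (Lb * 1) (cubic (d + 1) (evenPeriod t))) a ha k)⁻¹)) * (avgTow (QBlev L (fine (Lb * 1) (cubic (d + 1) (evenPeriod t)))) ((L : ℝ) ^ (d + 1)) (fun k => calGlev L (fine (Lb * 1) (cubic (d + 1) (evenPeriod t))) a ha k * Pmodel L (fine (Lb * 1) (cubic (d + 1) (evenPeriod t))) (V t i) k * (calGlev L (fine (Lb * 1) (cubic (d + 1) (evenPeriod t))) a ha k * Pmodel L (fine (Lb * 1) (cubic (d + 1) (evenPeriod t))) (V t j) k * calGlev L (fine (Lb * 1) (cubic (d + 1) (evenPeriod t))) a ha k)) k)).trace)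
        ((unitIdx L (fine (Lb * 1) (cubic (d + 1) (evenPeriod t)))).symm (castT (fine (Lb * 1) (cubic (d + 1) (evenPeriod t))) z, μ')) ((unitIdx L (fine (Lb * 1) (cubic (d + 1) (evenPeriod t)))).symm (0, ν'))) atTop (𝓝 s') := by
    intro k μ' ν' z
    have hD0 : (0 : ℝ) < ((d + 1 : ℕ) : ℝ) := by positivity
    have hκW' : 0 < κW / ((d + 1 : ℕ) : ℝ) := div_pos hκW hD0
    have hel0 : ∀ (μ₀ f : Fin (d + 1)) (w : Fin (d + 1) → ℤ), ∃ s : ℂ,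
        Tendsto (fun t => V t ((unitIdx L (fine (Lb * 1) (cubic (d + 1) (evenPeriod t)))).symm (0, ν')) k μ₀ (castT (fine (lev L k) (fine (Lb * 1) (cubic (d + 1) (evenPeriod t)))) w, f)) atTop (𝓝 s) := by
      intro μ₀ f w
      simpa only [castT_zero] using hel 0 ν' k μ₀ f w
    -- the window majorant from the three-point envelope
    have hWb : ∀ t (w₁ : Beta.Site (d + 1) (Lb * 1 * evenPeriod t)) (l₁ : Fin (d + 1)) (w₂ : Beta.Site (d + 1) (Lb * 1 * evenPeriod t)) (l₂ : Fin (d + 1)),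
        ‖(avgTow (QBlev L (fine (Lb * 1) (cubic (d + 1) (evenPeriod t)))) ((L : ℝ) ^ (d + 1)) (fun k => calGlev L (fine (Lb * 1) (cubic (d + 1) (evenPeriod t))) a ha k * Pmodel L (fine (Lb * 1) (cubic (d + 1) (evenPeriod t))) (V t ((unitIdx L (fine (Lb * 1) (cubic (d + 1) (evenPeriod t)))).symm (castT (fine (Lb * 1) (cubic (d + 1) (evenPeriod t))) z, μ'))) k * (calGlev L (fine (Lb * 1) (cubic (d + 1) (evenPeriod t))) a ha k * Pmodel L (fine (Lb * 1) (cubic (d + 1) (evenPeriod t))) (V t ((unitIdx L (fine (Lb * 1) (cubic (d + 1) (evenPeriod t)))).symm (0, ν'))) k * calGlev L (fine (Lb * 1) (cubic (d + 1) (evenPeriod t))) a ha k)) k) ((unitIdx L (fine (Lb * 1) (cubic (d + 1) (evenPeriod t)))).symm (w₂, l₂)) ((unitIdx L (fine (Lb * 1) (cubic (d + 1) (evenPeriod t)))).symm (w₁, l₁))‖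
          ≤ BW * (Real.exp (-(κW / ((d + 1 : ℕ) : ℝ)) * l1 (windowMap (d + 1) (Lb * 1 * evenPeriod t) (w₂ - castT (cubic (d + 1) (Lb * 1 * evenPeriod t)) z)))
            * Real.exp (-(κW / ((d + 1 : ℕ) : ℝ)) * l1 (windowMap (d + 1) (Lb * 1 * evenPeriod t) w₁))) := by
      intro t w₁ l₁ w₂ l₂
      have h := (hW (fine (Lb * 1) (cubic (d + 1) (evenPeriod t))) ((unitIdx L (fine (Lb * 1) (cubic (d + 1) (evenPeriod t)))).symm (castT (fine (Lb * 1) (cubic (d + 1) (evenPeriod t))) z, μ')) ((unitIdx L (fine (Lb * 1) (cubic (d + 1) (evenPeriod t)))).symm (0, ν'))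
        (V t _) (V t _) (hV t _) (hV t _) (hloc t _) (hloc t _)).1 k ((unitIdx L (fine (Lb * 1) (cubic (d + 1) (evenPeriod t)))).symm (w₂, l₂)) ((unitIdx L (fine (Lb * 1) (cubic (d + 1) (evenPeriod t)))).symm (w₁, l₁))
      refine h.trans (mul_le_mul_of_nonneg_left ?_ hBW)
      have hij : 0 ≤ distK L (fine (Lb * 1) (cubic (d + 1) (evenPeriod t))) ((unitIdx L (fine (Lb * 1) (cubic (d + 1) (evenPeriod t)))).symm (castT (fine (Lb * 1) (cubic (d + 1) (evenPeriod t))) z, μ')) ((unitIdx L (fine (Lb * 1) (cubic (d + 1) (evenPeriod t)))).symm (0, ν')) := distK_nonneg L _ _ _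
      have e1 := exp_distK_le_exp_window_pair' L (Lb * 1 * evenPeriod t) hκW.le (castT (cubic (d + 1) (Lb * 1 * evenPeriod t)) z) μ' w₂ l₂
      have e2 := exp_distK_le_exp_window_pair' L (Lb * 1 * evenPeriod t) hκW.le (0 : Beta.Site (d + 1) (Lb * 1 * evenPeriod t)) ν' w₁ l₁
      rw [sub_zero] at e2
      rw [distK_comm L _ _ ((unitIdx L (fine (Lb * 1) (cubic (d + 1) (evenPeriod t)))).symm (castT (fine (Lb * 1) (cubic (d + 1) (evenPeriod t))) z, μ')), distK_comm L _ ((unitIdx L (fine (Lb * 1) (cubic (d + 1) (evenPeriod t)))).symm (w₁, l₁))]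
      calc Real.exp (-(κW * (distK L (fine (Lb * 1) (cubic (d + 1) (evenPeriod t))) ((unitIdx L (fine (Lb * 1) (cubic (d + 1) (evenPeriod t)))).symm (castT (fine (Lb * 1) (cubic (d + 1) (evenPeriod t))) z, μ')) ((unitIdx L (fine (Lb * 1) (cubic (d + 1) (evenPeriod t)))).symm (w₂, l₂))
              + distK L (fine (Lb * 1) (cubic (d + 1) (evenPeriod t))) ((unitIdx L (fine (Lb * 1) (cubic (d + 1) (evenPeriod t)))).symm (castT (fine (Lb * 1) (cubic (d + 1) (evenPeriod t))) z, μ')) ((unitIdx L (fine (Lb * 1) (cubic (d + 1) (evenPeriod t)))).symm (0, ν'))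
              + distK L (fine (Lb * 1) (cubic (d + 1) (evenPeriod t))) ((unitIdx L (fine (Lb * 1) (cubic (d + 1) (evenPeriod t)))).symm (0, ν')) ((unitIdx L (fine (Lb * 1) (cubic (d + 1) (evenPeriod t)))).symm (w₁, l₁)))))
          ≤ Real.exp (-(κW * distK L (fine (Lb * 1) (cubic (d + 1) (evenPeriod t))) ((unitIdx L (fine (Lb * 1) (cubic (d + 1) (evenPeriod t)))).symm (castT (fine (Lb * 1) (cubic (d + 1) (evenPeriod t))) z, μ')) ((unitIdx L (fine (Lb * 1) (cubic (d + 1) (evenPeriod t)))).symm (w₂, l₂))))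
            * Real.exp (-(κW * distK L (fine (Lb * 1) (cubic (d + 1) (evenPeriod t))) ((unitIdx L (fine (Lb * 1) (cubic (d + 1) (evenPeriod t)))).symm (0, ν')) ((unitIdx L (fine (Lb * 1) (cubic (d + 1) (evenPeriod t)))).symm (w₁, l₁)))) := by
            rw [← Real.exp_add]; exact Real.exp_le_exp.mpr (by nlinarith)
        _ ≤ _ := mul_le_mul e1 e2 (Real.exp_pos _).le (Real.exp_pos _).le
    -- EL₂ of the word `[i,j]` (PART 199, two letters over `Bool`)
    have hWel : ∀ (l l' : Fin (d + 1)) (u v : Fin (d + 1) → ℤ), ∃ s' : ℂ,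
        Tendsto (fun t => (avgTow (QBlev L (fine (Lb * 1) (cubic (d + 1) (evenPeriod t)))) ((L : ℝ) ^ (d + 1)) (fun k => calGlev L (fine (Lb * 1) (cubic (d + 1) (evenPeriod t))) a ha k * Pmodel L (fine (Lb * 1) (cubic (d + 1) (evenPeriod t))) (V t ((unitIdx L (fine (Lb * 1) (cubic (d + 1) (evenPeriod t)))).symm (castT (fine (Lb * 1) (cubic (d + 1) (evenPeriod t))) z, μ'))) k * (calGlev L (fine (Lb * 1) (cubic (d + 1) (evenPeriod t))) a ha k * Pmodel L (fine (Lb * 1) (cubic (d + 1) (evenPeriod t))) (V t ((unitIdx L (fine (Lb * 1) (cubic (d + 1) (evenPeriod t)))).symm (0, ν'))) k * calGlev L (fine (Lb * 1) (cubic (d + 1) (evenPeriod t))) a ha k)) k) ((unitIdx L (fine (Lb * 1) (cubic (d + 1) (evenPeriod t)))).symm (castT (fine (Lb * 1) (cubic (d + 1) (evenPeriod t))) u, l)) ((unitIdx L (fine (Lb * 1) (cubic (d + 1) (evenPeriod t)))).symm (castT (fine (Lb * 1) (cubic (d + 1) (evenPeriod t))) v, l'))) atTop (𝓝 s') := by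
      intro l l' u v
      obtain ⟨s, hs⟩ := tendsto_word_pair_mul L a ha (d := d + 1) (by omega) (Lb * 1) k (σ := Bool)
        (V := fun b t => if b then V t ((unitIdx L (fine (Lb * 1) (cubic (d + 1) (evenPeriod t)))).symm (castT (fine (Lb * 1) (cubic (d + 1) (evenPeriod t))) z, μ')) else V t ((unitIdx L (fine (Lb * 1) (cubic (d + 1) (evenPeriod t)))).symm (0, ν')))
        (fun b t => by cases b <;> exact hV t _) (fun b μ₀ f w => by cases b <;> [exact hel0 μ₀ f w; exact hel z μ' k μ₀ f w]) [true, false] l l' u v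
      exact ⟨s, hs.congr fun t => rfl⟩
    obtain ⟨s', hs'⟩ := tendsto_traceContraction L (side := fun t => Lb * 1 * evenPeriod t) hside
      (Y := fun t => ((unitCovB L (fine (Lb * 1) (cubic (d + 1) (evenPeriod t))) a ha k)⁻¹ * (((flucCov (reM (DelK (lev L k) (one_le_lev' L k) (fine (Lb * 1) (cubic (d + 1) (evenPeriod t))) a ha)) (Matrix.fromRows (reM (QB 1 Lb (cubic (d + 1) (evenPeriod t)))) (fun (t' : {x : Tor (fine (Lb * 1) (cubic (d + 1) (evenPeriod t))) × Fin (d + 1) // (∀ ν, ν < x.2 → ((rem 1 Lb (cubic (d + 1) (evenPeriod t)) x.1 ν : ℕ)) = 0) ∧ ((rem 1 Lb (cubic (d + 1) (evenPeriod t)) x.1 x.2 : ℕ)) + 1 < Lb}) (x : Tor (fine (Lb * 1) (cubic (d + 1) (evenPeriod t))) × Fin (d + 1)) => if x = (Function.Embedding.subtype (fun x : Tor (fine (Lb * 1) (cubic (d + 1) (evenPeriod t))) × Fin (d + 1) => (∀ ν, ν < x.2 → ((rem 1 Lb (cubic (d + 1) (evenPeriod t)) x.1 ν : ℕ)) = 0)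 ∧ ((rem 1 Lb (cubic (d + 1) (evenPeriod t)) x.1 x.2 : ℕ)) + 1 < Lb)) t' then (1 : ℝ) else 0))).map ((↑) : ℝ → ℂ)).submatrix (unitIdx L (fine (Lb * 1) (cubic (d + 1) (evenPeriod t)))) (unitIdx L (fine (Lb * 1) (cubic (d + 1) (evenPeriod t))))) * (unitCovB L (fine (Lb * 1) (cubic (d + 1) (evenPeriod t))) a ha k)⁻¹)) (W := fun t => avgTow (QBlev L (fine (Lb * 1) (cubic (d + 1) (evenPeriod t)))) ((L : ℝ) ^ (d + 1)) (fun k => calGlev L (fine (Lb * 1) (cubic (d + 1) (evenPeriod t))) a ha k * Pmodel L (fine (Lb * 1) (cubic (d + 1) (evenPeriod t))) (V t ((unitIdx L (fine (Lb * 1) (cubic (d + 1) (evenPeriod t)))).symm (castT (fine (Lb * 1) (cubic (d + 1) (evenPeriod t))) z, μ'))) k * (calGlev L (fine (Lb * 1) (cubic (d + 1) (evenPeriod t))) a ha k * Pmodel L (fine (Lb * 1) (cubic (d + 1) (evenPeriod t))) (V t ((unitIdx L (fine (Lb * 1) (cubic (d + 1) (evenPeriod t)))).symm (0, ν'))) k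 * calGlev L (fine (Lb * 1) (cubic (d + 1) (evenPeriod t))) a ha k)) k)
      hBY hBW hκW' (fun t q r => hYb t k q r) z hWb (fun l l' u v => helY k l l' u v) hWel
    exact ⟨s', hs'.congr fun t => rfl⟩
  obtain ⟨Pinf, h1, h2, h3, h4, h5⟩ := conv_of_decay_of_tendsto L (d := d + 1) (by omega) hside hκW hθ0 hθ1 hud hsr hlim hne
  exact ⟨κW, BY * BW * S, (BY' * BW + BY * BW') * S, hκW, by positivity, by positivity, Pinf, h1, h2, h3, h4, h5⟩

/-- **`conv_traceContraction_tentWords` — THE SECOND TADPOLE FOR THE TENT FAMILY, NOTHING DISPLAYED** [our proof] (`d + 1 ≥ 3`, `L ≥ 2`, every `Lb ≥ 1`, `a > 0`, `μ ≠ ν`; the tent family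
`V_{t,x}^{(k)}(u) = [μ = x₂]·max(−ρ_{k,x}(u), 0)` DISPLAYED as the hypothesis `hVdef`). [cite: Balaban1987RG1, (1.20)–(1.22) p.264 (shapes)] -/
theorem conv_traceContraction_tentWords (hL : 2 ≤ L) (hd : 2 ≤ d) {μ ν : Fin (d + 1)} (hne : μ ≠ ν)
    {V : (t : ℕ) → idx L (fine (Lb * 1) (cubic (d + 1) (evenPeriod t))) 0 → (k : ℕ) → Fin (d + 1) → (idx L (fine (Lb * 1) (cubic (d + 1) (evenPeriod t))) k → ℂ)}
    (hVdef : ∀ t x k μ u, V t x k μ u = if μ = x.2 then (((max (-rho L (fine (Lb * 1) (cubic (d + 1) (evenPeriod t))) k x u) 0 : ℝ)) : ℂ) else 0) :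
    ∃ κ₁ C C' : ℝ, 0 < κ₁ ∧ 0 ≤ C ∧ 0 ≤ C' ∧ ∃ Pinf : ℕ → B12Beta.Kernel (d + 1),
      (∀ k, IsInfiniteVolumeLimit (fun t => Lb * 1 * evenPeriod t)
        (fun t μ' ν' (z : Beta.Site (d + 1) (Lb * 1 * evenPeriod t)) => (((((unitCovB L (fine (Lb * 1) (cubic (d + 1) (evenPeriod t))) a ha k)⁻¹ * (((flucCov (reM (DelK (lev L k) (one_le_lev' L k) (fine (Lb * 1) (cubic (d + 1) (evenPeriod t))) a ha)) (Matrix.fromRows (reM (QB 1 Lb (cubic (d + 1) (evenPeriod t)))) (fun (t' : {x : Tor (fine (Lb * 1) (cubic (d + 1) (evenPeriod t))) × Fin (d + 1) // (∀ ν, ν < x.2 → ((rem 1 Lb (cubic (d + 1) (evenPeriod t)) x.1 ν : ℕ)) = 0) ∧ ((rem 1 Lb (cubic (d + 1) (evenPeriod t)) x.1 x.2 : ℕ)) + 1 < Lb}) (x : Tor (fine (Lb * 1) (cubic (d + 1) (evenPeriod t))) × Fin (d + 1)) => if x = (Function.Embedding.subtype (fun x : Tor (fine (Lb * 1) (cubic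 (d + 1) (evenPeriod t))) × Fin (d + 1) => (∀ ν, ν < x.2 → ((rem 1 Lb (cubic (d + 1) (evenPeriod t)) x.1 ν : ℕ)) = 0) ∧ ((rem 1 Lb (cubic (d + 1) (evenPeriod t)) x.1 x.2 : ℕ)) + 1 < Lb)) t' then (1 : ℝ) else 0))).map ((↑) : ℝ → ℂ)).submatrix (unitIdx L (fine (Lb * 1) (cubic (d + 1) (evenPeriod t)))) (unitIdx L (fine (Lb * 1) (cubic (d + 1) (evenPeriod t))))) * (unitCovB L (fine (Lb * 1) (cubic (d + 1) (evenPeriod t))) a ha k)⁻¹)) * (avgTow (QBlev L (fine (Lb * 1) (cubic (d + 1) (evenPeriod t)))) ((L : ℝ) ^ (d + 1)) (fun k => calGlev L (fine (Lb * 1) (cubic (d + 1) (evenPeriod t))) a ha k * Pmodel L (fine (Lb * 1) (cubic (d + 1) (evenPeriod t))) (V t ((unitIdx L (fine (Lb * 1) (cubic (d + 1) (evenPeriod t)))).symm (z, μ'))) k * (calGlev L (fine (Lb * 1) (cubic (d + 1) (evenPeriod t))) a ha k * Pmodel L (fine (Lb * 1) (cubic (d + 1) (evenPeriod t))) (V t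 ((unitIdx L (fine (Lb * 1) (cubic (d + 1) (evenPeriod t)))).symm (0, ν'))) k * calGlev L (fine (Lb * 1) (cubic (d + 1) (evenPeriod t))) a ha k)) k)).trace).re) (Pinf k)) ∧
      Beta.LimitRate.UniformDecay Pinf μ ν C (κ₁ / (((d + 1 : ℕ)) : ℝ)) ∧
      StepRate Pinf μ ν C' (κ₁ / (((d + 1 : ℕ)) : ℝ)) (Real.sqrt ((L : ℝ)⁻¹)) ∧
      (∃ K : KernelInputs (d + 1) Pinf, K.θ = Real.sqrt ((L : ℝ)⁻¹) ∧ K.c₀ = betaPrime510 (d + 1) (C' / (1 - Real.sqrt ((L : ℝ)⁻¹))) (κ₁ / (((d + 1 : ℕ)) : ℝ)) ∧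
        K.Pinf = limKernelOf Pinf ∧ K.μ = μ ∧ K.ν = ν) ∧
      (∀ k, |B12Beta.secondMoment (Pinf k) μ ν - B12Beta.secondMoment (limKernelOf Pinf) μ ν|
          ≤ betaPrime510 (d + 1) (C' / (1 - Real.sqrt ((L : ℝ)⁻¹))) (κ₁ / (((d + 1 : ℕ)) : ℝ)) * Real.sqrt ((L : ℝ)⁻¹) ^ k) :=
  conv_traceContraction_insertionWords L Lb a ha hL hd hne (α := 1) (β := 1) (c₀ := 0)
    (fun t i => lipschitzBackground_tent L (fine (Lb * 1) (cubic (d + 1) (evenPeriod t))) (le_trans (by norm_num) hL) i (hVdef t i))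
    (fun t i k μ₀ u h => rho_nonpos_of_tent_ne_zero L (fine (Lb * 1) (cubic (d + 1) (evenPeriod t))) i (hVdef t i) k μ₀ u h)
    (fun z μ' k μ₀ f w => tendsto_tent_reading L (D := d + 1) (side := fun t => Lb * 1 * evenPeriod t)
      (Filter.Tendsto.const_mul_atTop' (Nat.pos_of_ne_zero (NeZero.ne (Lb * 1))) tendsto_evenPeriod) (V := V) hVdef z μ' k μ₀ f w)

end End


end Summit.QuantumFields.BalabanUV.Beta.GAN24.TwoVertexWordContraction

end
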